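import Literature.AlgebraicGeometry.ShimuraVarieties.UnitaryAuxiliaryHeckeQuotientDescent
import Literature.AlgebraicGeometry.ShimuraVarieties.UnitaryAuxiliaryReflexArtinSurjective
import Literature.AlgebraicGeometry.ShimuraVarieties.UnitaryAuxiliaryReflexArtinNorm
import Literature.AlgebraicGeometry.ShimuraVarieties.UnitaryShimuraReciprocityTwistInvariance
import Literature.AlgebraicGeometry.ShimuraVarieties.UnitaryAuxiliaryTorusClassNumberProofs
import Literature.AlgebraicGeometry.ShimuraVarieties.UnitaryAuxiliaryTorusUnitLevel
import HarnessLib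

/-!
# The Galois leg of `hDel` in GENERAL reflex degree: `F1 ⟹` an `E♯_Φ`-form of `Sh(U(H), 𝔹²)_ℂ` with Shimura
# reciprocity (62) for `Aut(ℂ/E♯)` and `L`-idèles, for EVERY adapted CM type `Φ`
# ([Deligne 1971] (5.11.1) + [Milne 2005] Def. 12.8 (59)–(62); hodgecm-mathlib B-I skeleton B1HeckeQuotientDescent v8 §8/§12/§13)

Topic `AlgebraicGeometry/ShimuraVarieties`; namespace
`Literature.AlgebraicGeometry.ShimuraVarieties.UnitaryCanonicalModel.HeckeQuotient` (sequel of B-p07's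
`UnitaryAuxiliaryHeckeQuotientDescent`, which proves the finite Hecke quotient (5.11.1) on B-typ03's auxiliary carriers
and the Galois leg under `HasSmallReflex`).  THEOREMS ONLY; texts = B-plan2's skeleton v8 (sha16 f802595652c86f41)
§8 `isCanonicalDescentAtReflex_of_overReflex_general`, `galoisLegDescentOver_general(_of)`, §12 `galoisLegDescentOver_final`,
§13 `galoisLegDescentOver_of_F1_only`, with the three T⁺ inputs INLINED BY TREE NAME: (a′) `Aux.artinSurjectiveReflex` /
`Aux.exists_finiteIdele_isArtinCorrespondent_reflexField` (p594845), (b′) `Aux.isArtinCorrespondent_finiteIdeleRelNorm`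
(p595207), (d′) `UnitaryCanonicalModel.kernelTwistInvariance` (p594589); g4 = `Aux.reflexNormFiniteIdele_mem_torusFinAdelic`
(p592936), g5 = `Aux.finite_classGroup_printed_holds` (p596070), g6 = `Aux.unitLevel` (p595606).  Landed by A-p05 per
B-plan2's landing call 02:10:40Z (B-p07 on (S2)).  Cell hodgecm-mathlib (D-0151); HC_CM is proved only modulo the 7
printed citations until rung 0 closes — everything here is conditional on F1 = `Aux.canonicalModel_exists_printed` where
it says so, and on nothing else.

WHAT IS PROVED.
* `isCanonicalDescentAtReflex_of_overReflex_general` — (62) over `E♯` for `E♯`-idèles ⟹ (62) over `E♯` for `L`-idèles,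
  for ANY adapted `Φ` (no `HasSmallReflex`): given `σ ∈ Aut(ℂ/E♯)` and an `L`-idèle `s` with `art_L(s) = σ|`, pick an
  `E♯`-idèle `s₁` for `σ` (a′), so `N s₁` is another `L`-Artin correspondent of `σ` (b′); (62) holds with the twist by
  `r_x(N s₁)`, and the twist classes of `s` and `N s₁` agree on `Sh_K(ℂ)` (d′).
* `galoisLegDescentOver_general` — the tree's `auxQuotientDescent` (finite Hecke quotient of F1's conclusion) followed by
  the above: at every hDel datum, every `Φ`, every `L₀` with finite class group, g4 and F1's conclusion ⟹ an `E♯`-form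
  `(M, e')` of `Sc.Mc` with `IsCanonicalDescentOver Sc (algebraMap ↥E♯ ℂ) M e'`.
* `galoisLegDescentOver_general_of_F1 (hF1)` (g4 discharged; instance binder `[Finite (Aux.classGroup L L₀)]`),
  `galoisLegDescentOver_final (hF1) (hg5)` (g5 as the named fact), `galoisLegDescentOver_of_F1_only (hF1)` (g5 DISCHARGED,
  `L₀ := Aux.unitLevel L`): the B-side deliverable of the Galois leg CONDITIONAL ON F1 ONLY.  A-plan1's stub (A)
  `stub_reflexCompositumModel` follows by the A-side tower step (`Summits/HodgeConjecture/CorCM/HypDel/A1ReflexCompositumModel`).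

References: [Deligne1971TravauxShimura] Prop. 5.11, (5.11.1), Cor. 5.7; [Deligne1979ShimuraVarieties] 2.2.5, 2.3.1;
[Milne2005ShimuraVarieties] (59) p. 107, Def. 12.8 (62) p. 114, Rem. 12.9 p. 115; [Shimura1998] §18.3.
-/

set_option autoImplicit false

noncomputable section

open Function MulAction Topology NumberField IsDedekindDomain CategoryTheory CategoryTheory.Limits Matrix
  AlgebraicGeometry
open scoped Matrix ComplexOrder
open Literature.AlgebraicGeometry Literature.AlgebraicGeometry.Motives
open Literature.NumberTheory.Automorphic Literature.NumberTheory.Automorphic.UnitaryGroup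
open Literature.NumberTheory.Automorphic.Liu2021.AppendixC (C5.OpenCompactSubgroup C5.SmallLevel)
open Literature.Geometry.ComplexHyperbolic Literature.Geometry.ComplexHyperbolic.BallModel
open Literature.NumberTheory.Automorphic.ShimuraDissection
open Literature.AlgebraicGeometry.ShimuraVarieties Literature.AlgebraicGeometry.ShimuraVarieties.UnitaryCanonicalModel
open Literature.NumberTheory.ComplexMultiplication (reflexNormFiniteIdele)
open Literature.NumberTheory.AdelicBaseChange (finiteIdeleRelNorm)

namespace Literature.AlgebraicGeometry.ShimuraVarieties

namespace UnitaryCanonicalModel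

namespace HeckeQuotient

/-! ### §1. Reflex transport in general degree: `E♯`-idèle reciprocity ⟹ `L`-idèle reciprocity over `E♯` -/

/-- **T⁺ transport** ([Milne2005ShimuraVarieties] Def. 12.8 (62) read with ANY Artin correspondent): for an `E♯`-form
`(M, e)` of `Sc.Mc`, reciprocity (62) for `Aut(ℂ/E♯)` stated with `E♯`-idèles (`IsCanonicalDescentOverReflex`) implies
(62) for `Aut(ℂ/E♯)` stated with `L`-idèles (`IsCanonicalDescentAtReflex`), for EVERY adapted CM type `Φ` — no
`HasSmallReflex`: an `E♯`-idèle `s₁` for `σ` exists (`Aux.exists_finiteIdele_isArtinCorrespondent_reflexField`), its norm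
`N_{E♯/L} s₁` is an `L`-Artin correspondent of `σ` (`Aux.isArtinCorrespondent_finiteIdeleRelNorm`), and the twists by
`r_x(s)` and `r_x(N s₁)` act identically on `Sh_K(ℂ)` (`kernelTwistInvariance`). [cite: Milne2005ShimuraVarieties, Def. 12.8 (59)–(62) pp. 107–114]
[cite: Shimura1998, §18.3 p. 122] -/
theorem isCanonicalDescentAtReflex_of_overReflex_general {L : Type} [Field L] [NumberField L] [IsCMField L]
    {H : Matrix (Fin 3) (Fin 3) L} {τ : L →+* ℂ} {T : GL (Fin 3) ℂ}
    {hT : formCongr (starRingEnd ℂ) T (H.map τ) = BallModel.J}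
    {K₀ : C5.OpenCompactSubgroup ↥(finAdelic (↥(maximalRealSubfield L)) L (IsCMField.complexConj L) 3 H)}
    (Φ : CMType L) (Sc : ComplexRecordSystem L H τ T hT K₀)
    {M : C5.SmallLevel K₀ ⥤ SchemeOver ↥(Aux.reflexField L Φ τ)}
    {e : (M ⋙ Motives.baseChange ↥(Aux.reflexField L Φ τ) ℂ) ≅ Sc.Mc}
    (h : IsCanonicalDescentOverReflex Φ Sc M e) : IsCanonicalDescentAtReflex Φ Sc M e := by
  intro K σ s hs v₃ x hx d hd a
  haveI : NumberField ↥(Aux.reflexField L Φ τ) := Aux.numberField_reflexField L Φ τ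
  letI : Algebra L ↥(Aux.reflexField L Φ τ) := (Aux.toReflexField L Φ τ).toAlgebra
  -- an `E♯`-idèle for `σ` (a′) and its norm, Artin-correspondent to `σ` over `L` (b′)
  obtain ⟨s₁, hs₁⟩ :=
    Aux.exists_finiteIdele_isArtinCorrespondent_reflexField L Φ τ σ.toRingEquiv fun y => σ.commutes y
  have hs' := Aux.isArtinCorrespondent_finiteIdeleRelNorm L Φ τ σ.toRingEquiv s₁ hs₁
  -- the twist of the norm exists: `H` hermitian (frame), `v₃` anisotropic (line point)
  have hH : ∀ i j, cmConjRingHom L (H i j) = H j i := cmConjRingHom_apply_eq_of_formCongr_eq_J L H τ T hT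
  have hv' : hermForm (cmConjRingHom L) H v₃ v₃ ≠ 0 := hermForm_self_ne_zero_of_isLinePoint L H τ T hT hx
  obtain ⟨d', hd'⟩ := exists_isDiagTwist_recipFactor H v₃ hH hv'
    (finiteIdeleRelNorm L ↥(Aux.reflexField L Φ τ) s₁)
  -- (62) over `E♯` at `(σ, s₁)` with the twist `d'`, then kernel-twist invariance `d ↔ d'`
  have h62 := h K σ s₁ hs₁ v₃ x hx d' hd' a
  have hk := kernelTwistInvariance L H τ T hT K₀ K σ.toRingEquiv s
    (finiteIdeleRelNorm L ↥(Aux.reflexField L Φ τ) s₁) hs hs' v₃ x hx d d' hd hd' a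
  rw [hk]
  exact h62

/-! ### §2. The Galois leg over `E♯` for every `Φ` -/

/-- **Galois leg over `E♯`, general degree** ([Deligne1971TravauxShimura] (5.11.1) + T⁺): at every hDel datum, EVERY
CM type `Φ`, every level `L₀` with finite class group, the reflex norms in `T₀(𝔸_f)` (g4) and F1's conclusion VERBATIM
⟹ an `E♯`-form `(M, e')` of `Sc.Mc` with `IsCanonicalDescentOver Sc (algebraMap ↥E♯ ℂ) M e'` (A-plan1's stub (A) inner
block at `E := E♯`).  The tree's `auxQuotientDescent` followed by `isCanonicalDescentAtReflex_of_overReflex_general`.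
[cite: Deligne1971TravauxShimura, Prop. 5.11, (5.11.1), Cor. 5.7] [cite: Milne2005ShimuraVarieties, Def. 12.8 (62) p. 114] -/
theorem galoisLegDescentOver_general :
    ∀ (L : Type) [Field L] [NumberField L] [IsCMField L] (H : Matrix (Fin 3) (Fin 3) L) (τ : L →+* ℂ)
      (T : GL (Fin 3) ℂ) (hT : formCongr (starRingEnd ℂ) T (H.map τ) = BallModel.J)
      (K₀ : C5.OpenCompactSubgroup ↥(finAdelic (↥(maximalRealSubfield L)) L (IsCMField.complexConj L) 3 H))
      (Sc : ComplexRecordSystem L H τ T hT K₀) (Φ : CMType L)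
      (L₀ : C5.OpenCompactSubgroup ↥(Aux.torusFinAdelic L)) [Finite (Aux.classGroup L L₀)],
      (haveI : NumberField ↥(Aux.reflexField L Φ τ) := Aux.numberField_reflexField L Φ τ
       ∀ s : (FiniteAdeleRing (𝓞 ↥(Aux.reflexField L Φ τ)) ↥(Aux.reflexField L Φ τ))ˣ,
         reflexNormFiniteIdele L Φ (Aux.reflexField L Φ τ) s ∈ Aux.torusFinAdelic L) →
      (∃ (N : C5.SmallLevel K₀ ⥤ SchemeOver ↥(Aux.reflexField L Φ τ))
          (ρ : ∀ K : C5.SmallLevel K₀, Aux.classGroup L L₀ →* Aut (N.obj K))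
          (e : (N ⋙ Motives.baseChange ↥(Aux.reflexField L Φ τ) ℂ) ≅ Aux.complexSystem Sc L₀),
          (∀ (K K' : C5.SmallLevel K₀) (f : K ⟶ K') (c : Aux.classGroup L L₀),
              (ρ K c).hom ≫ N.map f = N.map f ≫ (ρ K' c).hom) ∧
          (∀ (K : C5.SmallLevel K₀) (c : Aux.classGroup L L₀),
              (Motives.baseChange ↥(Aux.reflexField L Φ τ) ℂ).map (ρ K c).hom ≫ e.hom.app K =
                e.hom.app K ≫ Aux.translMor Sc L₀ K c) ∧
          Aux.IsCanonicalDescentAt Φ L₀ Sc N e) →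
      ∃ (M : C5.SmallLevel K₀ ⥤ SchemeOver ↥(Aux.reflexField L Φ τ))
        (e' : (M ⋙ Motives.baseChange ↥(Aux.reflexField L Φ τ) ℂ) ≅ Sc.Mc),
        IsCanonicalDescentOver Sc (algebraMap ↥(Aux.reflexField L Φ τ) ℂ) M e' := by
  intro L _ _ _ H τ T hfr K₀ Sc Φ L₀ _ hg4 hF1
  obtain ⟨M, e', hM⟩ := auxQuotientDescent L H τ T hfr K₀ Sc Φ L₀ hg4 hF1
  exact ⟨M, e', (isCanonicalDescentAtReflex_iff_over Φ Sc M e').1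
    (isCanonicalDescentAtReflex_of_overReflex_general Φ Sc hM)⟩

/-- **Galois leg over `E♯` from F1, every adapted `Φ`, finiteness as an instance binder** (g4 discharged by
`Aux.reflexNormFiniteIdele_mem_torusFinAdelic`): the hypothesis `hGL` of the A-side assembly
`stub_reflexCompositumModel_of_galoisLegOver`, VERBATIM. [cite: Deligne1971TravauxShimura, (5.11.1)]
[cite: Milne2005ShimuraVarieties, Def. 12.8 (62) p. 114] -/
theorem galoisLegDescentOver_general_of_F1 (hF1 : Aux.canonicalModel_exists_printed) :
    ∀ (L : Type) [Field L] [NumberField L] [IsCMField L] (H : Matrix (Fin 3) (Fin 3) L) (τ : L →+* ℂ)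
      (T : GL (Fin 3) ℂ) (hT : formCongr (starRingEnd ℂ) T (H.map τ) = BallModel.J),
      (∀ τ' : L →+* ℂ, InfinitePlace.mk τ' ≠ InfinitePlace.mk τ → (H.map τ').PosDef) →
      (∀ v : Fin 3 → L, hermForm (cmConjRingHom L) H v v = 0 → v = 0) →
      ∀ K₀ : C5.OpenCompactSubgroup ↥(finAdelic (↥(maximalRealSubfield L)) L (IsCMField.complexConj L) 3 H),
        (∀ g : finAdelic (↥(maximalRealSubfield L)) L (IsCMField.complexConj L) 3 H,
          ∀ γ ∈ arithmeticLevel (↥(maximalRealSubfield L)) L (IsCMField.complexConj L) 3 H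
            (K₀.1.map (MulAut.conj g).toMonoidHom), IsOfFinOrder γ → γ = 1) →
        ∀ (Sc : ComplexRecordSystem L H τ T hT K₀) (Φ : CMType L), Aux.IsAdapted L Φ τ →
          ∀ (L₀ : C5.OpenCompactSubgroup ↥(Aux.torusFinAdelic L)) [Finite (Aux.classGroup L L₀)],
            ∃ (M : C5.SmallLevel K₀ ⥤ SchemeOver ↥(Aux.reflexField L Φ τ))
              (e' : (M ⋙ Motives.baseChange ↥(Aux.reflexField L Φ τ) ℂ) ≅ Sc.Mc),
              IsCanonicalDescentOver Sc (algebraMap ↥(Aux.reflexField L Φ τ) ℂ) M e' := by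
  intro L _ _ _ H τ T hfr hpos han K₀ hneat Sc Φ hΦ L₀ _
  exact galoisLegDescentOver_general L H τ T hfr K₀ Sc Φ L₀
    (Aux.reflexNormFiniteIdele_mem_torusFinAdelic L Φ τ) (hF1 L H τ T hfr hpos han K₀ hneat Sc Φ hΦ L₀)

/-- **FINAL B-SIDE HEAD with the class-number finiteness as the named fact g5** (`Aux.finite_classGroup_printed`,
[BorelIHES1963] Thm. 5.1): every hDel datum, every adapted `Φ`, EVERY open compact `L₀`.
[cite: Deligne1971TravauxShimura, (5.11.1)] [cite: Milne2005ShimuraVarieties, Def. 12.8 (62) p. 114] -/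
theorem galoisLegDescentOver_final (hF1 : Aux.canonicalModel_exists_printed) (hg5 : Aux.finite_classGroup_printed) :
    ∀ (L : Type) [Field L] [NumberField L] [IsCMField L] (H : Matrix (Fin 3) (Fin 3) L) (τ : L →+* ℂ)
      (T : GL (Fin 3) ℂ) (hT : formCongr (starRingEnd ℂ) T (H.map τ) = BallModel.J),
      (∀ τ' : L →+* ℂ, InfinitePlace.mk τ' ≠ InfinitePlace.mk τ → (H.map τ').PosDef) →
      (∀ v : Fin 3 → L, hermForm (cmConjRingHom L) H v v = 0 → v = 0) →
      ∀ K₀ : C5.OpenCompactSubgroup ↥(finAdelic (↥(maximalRealSubfield L)) L (IsCMField.complexConj L) 3 H),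
        (∀ g : finAdelic (↥(maximalRealSubfield L)) L (IsCMField.complexConj L) 3 H,
          ∀ γ ∈ arithmeticLevel (↥(maximalRealSubfield L)) L (IsCMField.complexConj L) 3 H
            (K₀.1.map (MulAut.conj g).toMonoidHom), IsOfFinOrder γ → γ = 1) →
        ∀ (Sc : ComplexRecordSystem L H τ T hT K₀) (Φ : CMType L), Aux.IsAdapted L Φ τ →
          ∀ (L₀ : C5.OpenCompactSubgroup ↥(Aux.torusFinAdelic L)),
            ∃ (M : C5.SmallLevel K₀ ⥤ SchemeOver ↥(Aux.reflexField L Φ τ))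
              (e' : (M ⋙ Motives.baseChange ↥(Aux.reflexField L Φ τ) ℂ) ≅ Sc.Mc),
              IsCanonicalDescentOver Sc (algebraMap ↥(Aux.reflexField L Φ τ) ℂ) M e' := by
  intro L _ _ _ H τ T hfr hpos han K₀ hneat Sc Φ hΦ L₀
  haveI : Finite (Aux.classGroup L L₀) := hg5 L L₀
  exact galoisLegDescentOver_general_of_F1 hF1 L H τ T hfr hpos han K₀ hneat Sc Φ hΦ L₀

/-- **B-SIDE DELIVERABLE OF THE GALOIS LEG, CONDITIONAL ON THE ONE PRINTED CITATION F1**: g5 DISCHARGED by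
`Aux.finite_classGroup_printed_holds` (B-p01), level `L₀ := Aux.unitLevel L` (B-p15); for every hDel datum with the F1
side conditions, every neat `K₀`, every `Sc` and EVERY `τ`-adapted `Φ`, an `E♯`-form of `Sc.Mc` with Milne's (62) for all
`σ ∈ Aut(ℂ/E♯)` and all Artin-correspondent `L`-idèles. [cite: Deligne1971TravauxShimura, (5.11.1)]
[cite: Milne2005ShimuraVarieties, Def. 12.8 (62) p. 114] -/
theorem galoisLegDescentOver_of_F1_only (hF1 : Aux.canonicalModel_exists_printed) :
    ∀ (L : Type) [Field L] [NumberField L] [IsCMField L] (H : Matrix (Fin 3) (Fin 3) L) (τ : L →+* ℂ)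
      (T : GL (Fin 3) ℂ) (hT : formCongr (starRingEnd ℂ) T (H.map τ) = BallModel.J),
      (∀ τ' : L →+* ℂ, InfinitePlace.mk τ' ≠ InfinitePlace.mk τ → (H.map τ').PosDef) →
      (∀ v : Fin 3 → L, hermForm (cmConjRingHom L) H v v = 0 → v = 0) →
      ∀ K₀ : C5.OpenCompactSubgroup ↥(finAdelic (↥(maximalRealSubfield L)) L (IsCMField.complexConj L) 3 H),
        (∀ g : finAdelic (↥(maximalRealSubfield L)) L (IsCMField.complexConj L) 3 H,
          ∀ γ ∈ arithmeticLevel (↥(maximalRealSubfield L)) L (IsCMField.complexConj L) 3 H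
            (K₀.1.map (MulAut.conj g).toMonoidHom), IsOfFinOrder γ → γ = 1) →
        ∀ (Sc : ComplexRecordSystem L H τ T hT K₀) (Φ : CMType L), Aux.IsAdapted L Φ τ →
            ∃ (M : C5.SmallLevel K₀ ⥤ SchemeOver ↥(Aux.reflexField L Φ τ))
              (e' : (M ⋙ Motives.baseChange ↥(Aux.reflexField L Φ τ) ℂ) ≅ Sc.Mc),
              IsCanonicalDescentOver Sc (algebraMap ↥(Aux.reflexField L Φ τ) ℂ) M e' := by
  intro L _ _ _ H τ T hfr hpos han K₀ hneat Sc Φ hΦ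
  exact galoisLegDescentOver_final hF1 Aux.finite_classGroup_printed_holds L H τ T hfr hpos han K₀ hneat Sc Φ hΦ
    (Aux.unitLevel L)

end HeckeQuotient

end UnitaryCanonicalModel

end Literature.AlgebraicGeometry.ShimuraVarieties

end
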